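import Mathlib.AlgebraicGeometry.IdealSheaf.Basic
import Mathlib.AlgebraicGeometry.IdealSheaf.Functorial
import Mathlib.AlgebraicGeometry.IdealSheaf.Subscheme
import Mathlib.AlgebraicGeometry.Noetherian
import Mathlib.AlgebraicGeometry.AffineScheme
import HarnessLib

/-!
# The ideal sheaf of a point-supported centre given on one affine chart

Support file for crux stmt-ResolutionOfSingularities-15315
(`FrobeniusLadder.FInjectiveMacaulayfication`, line `Sketch`, seat c6): stub
`stub_pointCentreIdealSheaf`.

To iterate blow-ups on a non-affine intermediate model `X` (locally Noetherian) one picks a centre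
`I ⊆ Γ(X, U)` on one affine chart `U`, co-supported at a single closed point `b ∈ U` (the primes
of `Γ(X, U)` containing `I` are exactly the one corresponding to `b`), and needs it as a global
ideal sheaf `J` on `X` with `J(U) = I`, `supp J = {b}`, and `J(V)` the unit ideal on every affine
open `V ∌ b`.

Construction: `J` is the kernel (`AlgebraicGeometry.Scheme.Hom.ker`) of the composite
`f : Spec (Γ(X, U) ⧸ I) ⟶ Spec Γ(X, U) ⟶ X` of `Spec` of the quotient map with the canonical
open immersion `fromSpec` of the affine chart. The source is the spectrum of a Noetherian ring,
hence a Noetherian space, so `f` is quasi-compact and Mathlib's `Scheme.Hom.ker_apply` and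
`Scheme.Hom.support_ker` apply:
* `J(U)` is the kernel of the map on sections `Γ(X, U) ⟶ Γ(Spec (Γ(X, U) ⧸ I), f⁻¹ U)`, which
  is the quotient map followed by an isomorphism (computed with the `appLE` calculus), so
  `J(U) = I`;
* `supp J` is the closure of the range of `f`, and the range is `fromSpec '' V(I) = {b}` by the
  hypothesis on `I` (points of `U` correspond to primes of `Γ(X, U)` via `primeIdealOf`), which
  is closed;
* on an affine open `V ∌ b` the zero locus of `J(V)` in `Spec Γ(X, V)` maps onto
  `supp J ∩ V = ∅`, so `J(V)` is the unit ideal.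

References: folklore bookkeeping over Mathlib's `AlgebraicGeometry.IdealSheaf` API (closed
subschemes, their ideal sheaves and scheme-theoretic supports, cf. The Stacks Project,
Tags 01J3 and 01R8); no definition is declared. [folklore]
-/

-- single-problem summit: the doubled namespace component `ResolutionOfSingularities` is forced
set_option linter.dupNamespace false

noncomputable section

namespace Summit.ResolutionOfSingularities.ResolutionOfSingularities.Theorems.FInjectiveMacaulayfication.PointCentreIdealSheaf

open AlgebraicGeometry CategoryTheory TopologicalSpace

universe u

/-- Composing with an isomorphism of commutative rings on the right does not change the kernel:
`ker (f ≫ g) = ker f` for `g` invertible. [folklore] -/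
theorem ker_hom_comp_of_isIso {A B C : CommRingCat.{u}} (f : A ⟶ B) (g : B ⟶ C) [IsIso g] :
    RingHom.ker (f ≫ g).hom = RingHom.ker f.hom :=
  RingHom.ker_equiv_comp f.hom (asIso g).commRingCatIsoToRingEquiv

/-- For an affine open `U` of a scheme `X`, the map on sections `Γ(X, U) ⟶ Γ(Spec Γ(X, U), ⊤)`
induced by the canonical open immersion `fromSpec : Spec Γ(X, U) ⟶ X` (whose preimage of `U` is
everything) is the inverse of the canonical isomorphism `Γ(Spec Γ(X, U), ⊤) ≅ Γ(X, U)`.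
[folklore] -/
theorem fromSpec_appLE_top {X : Scheme.{u}} {U : X.Opens} (hU : IsAffineOpen U)
    (h : (⊤ : (Spec Γ(X, U)).Opens) ≤ hU.fromSpec ⁻¹ᵁ U) :
    hU.fromSpec.appLE U ⊤ h = (Scheme.ΓSpecIso Γ(X, U)).inv := by
  rw [Scheme.Hom.appLE, hU.fromSpec_app_of_le U le_rfl]
  simp only [Category.assoc, ← Functor.map_comp, ← op_comp, homOfLE_comp, homOfLE_refl, op_id,
    CategoryTheory.Functor.map_id, Category.comp_id, Category.id_comp]

/-- For an affine open `U` of a scheme `X` and a ring map `q : Γ(X, U) ⟶ B`, the map on sections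
over `U` induced by the composite `Spec B ⟶ Spec Γ(X, U) ⟶ X` has the same kernel as `q`: up to
the isomorphism `Γ(Spec B, f⁻¹ U) = Γ(Spec B, ⊤) ≅ B` it is `q` itself. [folklore] -/
theorem ker_app_SpecMap_comp_fromSpec {X : Scheme.{u}} {U : X.Opens} (hU : IsAffineOpen U)
    {B : CommRingCat.{u}} (q : Γ(X, U) ⟶ B) :
    RingHom.ker ((Spec.map q ≫ hU.fromSpec).app U).hom = RingHom.ker q.hom := by
  have h₁ : (⊤ : (Spec Γ(X, U)).Opens) ≤ hU.fromSpec ⁻¹ᵁ U := hU.fromSpec_preimage_self.ge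
  have h₂ : (⊤ : (Spec B).Opens) ≤ Spec.map q ⁻¹ᵁ ⊤ := (Opens.map_top _).ge
  have e : (⊤ : (Spec B).Opens) = (Spec.map q ≫ hU.fromSpec) ⁻¹ᵁ U := by
    show ⊤ = Spec.map q ⁻¹ᵁ (hU.fromSpec ⁻¹ᵁ U)
    rw [hU.fromSpec_preimage_self]
    exact (Opens.map_top _).symm
  -- the map on sections, followed by the identification `Γ(Spec B, f⁻¹ U) = Γ(Spec B, ⊤)`,
  -- is `q` followed by `B ≅ Γ(Spec B, ⊤)`
  have key : (Spec.map q ≫ hU.fromSpec).app U ≫ (Spec B).presheaf.map (eqToHom e).op =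
      q ≫ (Scheme.ΓSpecIso B).inv := by
    rw [Scheme.Hom.app_eq_appLE, Scheme.Hom.appLE_map,
      ← Scheme.Hom.appLE_comp_appLE (Spec.map q) hU.fromSpec U ⊤ ⊤ h₁ h₂,
      fromSpec_appLE_top hU h₁, Scheme.ΓSpecIso_inv_naturality]
    rfl
  rw [← ker_hom_comp_of_isIso _ ((Spec B).presheaf.map (eqToHom e).op), key,
    ker_hom_comp_of_isIso]

/-- The range of the closed immersion `Spec (A ⧸ I) ⟶ Spec A` is the zero locus `V(I)`.
[folklore] -/
theorem range_SpecMap_quotient_mk {A : CommRingCat.{u}} (I : Ideal A) :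
    Set.range (Spec.map (CommRingCat.ofHom (Ideal.Quotient.mk I) : A ⟶ CommRingCat.of (A ⧸ I))) =
      PrimeSpectrum.zeroLocus (I : Set A) := by
  ext x
  have h := range_comap_of_surjective _ (Ideal.Quotient.mk I) Ideal.Quotient.mk_surjective
  rw [Ideal.mk_ker] at h
  exact Set.ext_iff.mp h x

/-- For an affine open `U` of a scheme `X`, the prime of `Γ(X, U)` corresponding to the point
`fromSpec p ∈ U` is `p` itself (`fromSpec` is injective). [folklore] -/
theorem primeIdealOf_fromSpec {X : Scheme.{u}} {U : X.Opens} (hU : IsAffineOpen U)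
    (p : Spec Γ(X, U)) (h : hU.fromSpec p ∈ U) : hU.primeIdealOf ⟨hU.fromSpec p, h⟩ = p :=
  hU.fromSpec.isOpenEmbedding.injective (hU.fromSpec_primeIdealOf ⟨_, h⟩)

/-- Points in the image of `fromSpec : Spec Γ(X, U) ⟶ X` (whose range is `U`) lie in `U`.
[folklore] -/
theorem fromSpec_mem {X : Scheme.{u}} {U : X.Opens} (hU : IsAffineOpen U)
    (p : Spec Γ(X, U)) : hU.fromSpec p ∈ U := by
  rw [← SetLike.mem_coe, ← hU.range_fromSpec]
  exact Set.mem_range_self p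

/-- If the support of an ideal sheaf `J` misses an affine open `V`, then `J(V)` is the unit
ideal: the zero locus of `J(V)` in `Spec Γ(X, V)` maps onto `supp J ∩ V = ∅`. [folklore] -/
theorem ideal_eq_top_of_support_inter_eq_empty {X : Scheme.{u}} (J : X.IdealSheafData)
    (V : X.affineOpens) (h : (J.support : Set X) ∩ V = ∅) : J.ideal V = ⊤ := by
  have := (V.2.fromSpec_image_zeroLocus (J.ideal V : Set Γ(X, V))).trans
    ((J.coe_support_inter V).symm.trans h)
  rw [Set.image_eq_empty] at this
  exact PrimeSpectrum.zeroLocus_empty_iff_eq_top.mp this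

/-- **Point-centre ideal sheaf.** Let `X` be a locally Noetherian scheme, `U` an affine open,
`I ⊆ Γ(X, U)` an ideal and `b ∈ U` a closed point of `X` such that the primes of `Γ(X, U)`
containing `I` are exactly the one corresponding to `b`. Then there is an ideal sheaf `J` on `X`
with `J(U) = I`, `supp J = {b}`, and `J(V)` the unit ideal for every affine open `V ∌ b`
(namely the kernel of `Spec (Γ(X, U) ⧸ I) ⟶ Spec Γ(X, U) ⟶ X`). [folklore] -/
theorem stub_pointCentreIdealSheaf : ∀ (X : Scheme.{0}) [IsLocallyNoetherian X] (U : X.affineOpens)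
    (I : Ideal Γ(X, U)) (b : X) (hb : b ∈ (U : X.Opens)), IsClosed ({b} : Set X) →
    (∀ (x : X) (hx : x ∈ (U : X.Opens)), I ≤ (U.2.primeIdealOf ⟨x, hx⟩).asIdeal ↔ x = b) →
    ∃ J : X.IdealSheafData, J.ideal U = I ∧ (J.support : Set X) = {b} ∧
      ∀ V : X.affineOpens, b ∉ (V : X.Opens) → J.ideal V = ⊤ := by
  intro X _ U I b hb hcl hzero
  -- the quotient map `q : Γ(X, U) ⟶ Γ(X, U) ⧸ I`, its kernel and the range of `Spec q`
  obtain ⟨q, hq⟩ : ∃ q : Γ(X, U) ⟶ CommRingCat.of (Γ(X, U) ⧸ I),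
      q = CommRingCat.ofHom (Ideal.Quotient.mk I) := ⟨_, rfl⟩
  have hkq : RingHom.ker q.hom = I := by rw [hq, CommRingCat.hom_ofHom, Ideal.mk_ker]
  have hrq : Set.range (Spec.map q) = PrimeSpectrum.zeroLocus (I : Set Γ(X, U)) := by
    rw [hq]; exact range_SpecMap_quotient_mk I
  -- the source of `f := Spec q ≫ fromSpec : Spec (Γ(X, U) ⧸ I) ⟶ X` is a Noetherian space,
  -- so `f` is quasi-compact
  haveI : IsNoetherianRing Γ(X, U) := IsLocallyNoetherian.component_noetherian U
  haveI : NoetherianSpace (Spec (CommRingCat.of (Γ(X, U) ⧸ I))) := inferInstance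
  -- the range of `f` is `{b}`
  have hrange : Set.range (Spec.map q ≫ U.2.fromSpec) = ({b} : Set X) := by
    ext x
    simp only [Set.mem_range, Set.mem_singleton_iff, Scheme.Hom.comp_apply]
    constructor
    · rintro ⟨p, rfl⟩
      refine (hzero _ (fromSpec_mem U.2 _)).mp ?_
      rw [primeIdealOf_fromSpec]
      have hp : Spec.map q p ∈ PrimeSpectrum.zeroLocus (I : Set Γ(X, U)) := by
        rw [← hrq]; exact Set.mem_range_self p
      exact SetLike.coe_subset_coe.mp ((PrimeSpectrum.mem_zeroLocus _ _).mp hp)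
    · intro hxb
      obtain ⟨p, hp⟩ : U.2.primeIdealOf ⟨b, hb⟩ ∈ Set.range (Spec.map q) := by
        rw [hrq]
        exact (PrimeSpectrum.mem_zeroLocus _ _).mpr
          (SetLike.coe_subset_coe.mpr ((hzero b hb).mpr rfl))
      exact ⟨p, by rw [hp, IsAffineOpen.fromSpec_primeIdealOf]; exact hxb.symm⟩
  -- hence the support of `ker f` is `closure {b} = {b}`
  have hsupp : ((Spec.map q ≫ U.2.fromSpec).ker.support : Set X) = {b} := by
    rw [Scheme.Hom.support_ker, hrange, hcl.closure_eq]
  refine ⟨(Spec.map q ≫ U.2.fromSpec).ker, ?_, hsupp, fun V hV => ?_⟩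
  · rw [Scheme.Hom.ker_apply]
    exact (ker_app_SpecMap_comp_fromSpec U.2 q).trans hkq
  · apply ideal_eq_top_of_support_inter_eq_empty
    rw [hsupp]
    exact Set.singleton_inter_eq_empty.mpr hV

end Summit.ResolutionOfSingularities.ResolutionOfSingularities.Theorems.FInjectiveMacaulayfication.PointCentreIdealSheaf

end
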